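import Literature.Computability.AlgebraicComplexity.Kron444HullCheck
import HarnessLib

/-!
# `Kron(4,4,4) ⊆ conv(328 vertices)`: certificate checks, part 5/14

Proofs file (computations only): the node checks of `Kron444HullCheck.lean` for the chunks
56 … 69 of the certificate, each decided by the kernel (`decide +kernel`; `maxHeartbeats 0`:
a chunk is ≈ 10⁵–10⁶ kernel reductions). Assembled in `Kron444Hull.lean`. [folklore]
-/

set_option Elab.async false

namespace Literature.Computability.AlgebraicComplexity.Kron444Hull

/-- Nodes `1400 … 1424` of the certificate (chunk `56`) pass `checkNodeRec`. [folklore] -/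
theorem checkChunk_56 : checkChunk 56 25 = true := by
  set_option maxHeartbeats 0 in decide +kernel

/-- Nodes `1425 … 1449` of the certificate (chunk `57`) pass `checkNodeRec`. [folklore] -/
theorem checkChunk_57 : checkChunk 57 25 = true := by
  set_option maxHeartbeats 0 in decide +kernel

/-- Nodes `1450 … 1474` of the certificate (chunk `58`) pass `checkNodeRec`. [folklore] -/
theorem checkChunk_58 : checkChunk 58 25 = true := by
  set_option maxHeartbeats 0 in decide +kernel

/-- Nodes `1475 … 1499` of the certificate (chunk `59`) pass `checkNodeRec`. [folklore] -/
theorem checkChunk_59 : checkChunk 59 25 = true := by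
  set_option maxHeartbeats 0 in decide +kernel

/-- Nodes `1500 … 1524` of the certificate (chunk `60`) pass `checkNodeRec`. [folklore] -/
theorem checkChunk_60 : checkChunk 60 25 = true := by
  set_option maxHeartbeats 0 in decide +kernel

/-- Nodes `1525 … 1549` of the certificate (chunk `61`) pass `checkNodeRec`. [folklore] -/
theorem checkChunk_61 : checkChunk 61 25 = true := by
  set_option maxHeartbeats 0 in decide +kernel

/-- Nodes `1550 … 1574` of the certificate (chunk `62`) pass `checkNodeRec`. [folklore] -/
theorem checkChunk_62 : checkChunk 62 25 = true := by
  set_option maxHeartbeats 0 in decide +kernel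

/-- Nodes `1575 … 1599` of the certificate (chunk `63`) pass `checkNodeRec`. [folklore] -/
theorem checkChunk_63 : checkChunk 63 25 = true := by
  set_option maxHeartbeats 0 in decide +kernel

/-- Nodes `1600 … 1624` of the certificate (chunk `64`) pass `checkNodeRec`. [folklore] -/
theorem checkChunk_64 : checkChunk 64 25 = true := by
  set_option maxHeartbeats 0 in decide +kernel

/-- Nodes `1625 … 1649` of the certificate (chunk `65`) pass `checkNodeRec`. [folklore] -/
theorem checkChunk_65 : checkChunk 65 25 = true := by
  set_option maxHeartbeats 0 in decide +kernel

/-- Nodes `1650 … 1674` of the certificate (chunk `66`) pass `checkNodeRec`. [folklore] -/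
theorem checkChunk_66 : checkChunk 66 25 = true := by
  set_option maxHeartbeats 0 in decide +kernel

/-- Nodes `1675 … 1699` of the certificate (chunk `67`) pass `checkNodeRec`. [folklore] -/
theorem checkChunk_67 : checkChunk 67 25 = true := by
  set_option maxHeartbeats 0 in decide +kernel

/-- Nodes `1700 … 1724` of the certificate (chunk `68`) pass `checkNodeRec`. [folklore] -/
theorem checkChunk_68 : checkChunk 68 25 = true := by
  set_option maxHeartbeats 0 in decide +kernel

/-- Nodes `1725 … 1749` of the certificate (chunk `69`) pass `checkNodeRec`. [folklore] -/
theorem checkChunk_69 : checkChunk 69 25 = true := by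
  set_option maxHeartbeats 0 in decide +kernel

end Literature.Computability.AlgebraicComplexity.Kron444Hull
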